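import Literature.AlgebraicGeometry.Resolution.BadCurveInduction
import HarnessLib

/-!
# Zariski–Piltant two-model patching at transcendence degree `d`: reduction to ONE typed step,
«straddle elimination» [OURS · L1 W5.2 · K5.2c re-key rung]

[OURS · L1 W5.2] replaces the role of nothing in the manuscript; NOT a statement of Hironaka 2017.
AI-written; weaker than expert review.

The tree proves Piltant's Prop. 5.1 for `P = P_reg` at `trdeg_k K = 3`
(`ProjModel.twoModelPatching_of_principalization`, `BadCurveInduction.lean`) in three moves:
Step 2 (`exists_hom_regLe_of_regPrincipalization`, dimension-free given principalization on
`Reg M₂`), the BAD-CURVE INDUCTION (`exists_step` / `badMeasure_lt`, transcendence degree `3`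
only: bad points have coheight `2` and the measure is quadratic accessibility), and Step 5
(`exists_regLe_pair_of_closure_subset`, dimension-free given principalization on the open
`U ⊆ Reg A` and the hypothesis «no bad point»: `closure (Ind ∩ U) ⊆ U`).

Kill test K5.2c of the W5.2 chain (2026-08-26) located the ONLY transcendence-degree-`3`
ingredient: reaching «no bad point» (here: `StraddleFree`) by `Reg`-preserving modifications.
This file TYPES that ingredient as one dimension-indexed statement `StraddleElimination d` and
proves, sorry-free:

* `straddleElimination_three` — it HOLDS at `d = 3` (the tree's induction, re-run with the
  conclusion «no bad point» instead of the final pair), modulo `CossartPiltant2019Principalization`;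
* `exists_regLe_pair_of_straddleElimination` — at ANY `d`, principalization on regular excellent
  `d`-folds (Piltant's Axiom 4 for `P_reg`, the body of `K52.PrincipalizationDim d` unfolded) +
  `StraddleElimination d` give Piltant's Prop. 5.1 conclusion (two projective models are dominated
  by one on which both regular loci have regular preimage).

So at `d = 4` the Zariski–Piltant architecture is EXACTLY «Axiom 4₄ ∧ StraddleElimination 4»;
`StraddleElimination 4` is the typed form of the located coheight-`3` step (straddling CURVES of
fourfolds; Cutkosky, Amer. J. Math. 131 (2009) p. 14: «This fails completely in higher
dimensions»). A candidate device for it (tower alignment at coheight-`3` points; local measure =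
tower length; global termination open) is recorded in the chain's cell notes, not here.

## References
* O. Piltant, RACSAM 107 (2013) 91–121, Prop. 5.1 (Steps 2–5), Lemma 5.6. [Piltant2013]
* V. Cossart, O. Piltant, J. Algebra 529 (2019), Prop. 4.4 (arXiv:1412.0868v1 Prop. 4.3).
  [CossartPiltant2019]
* S. D. Cutkosky, Amer. J. Math. 131 (2009) 59–127, p. 14. [Cutkosky2009]
-/

-- `Summit.<Summit>.<Sub>.Theorems` with `Sub = Summit` (single-conjunct summit, D-0017)
set_option linter.dupNamespace false

noncomputable section

open CategoryTheory AlgebraicGeometry TopologicalSpace IsLocalRing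
open Literature.AlgebraicGeometry.Resolution Literature.AlgebraicGeometry.Resolution.ProjModel

universe u

namespace Summit.ResolutionOfSingularities.ResolutionOfSingularities.Theorems

namespace K52c

/-! ## The typed step -/

/-- **No straddling component** for the state `(A, U, B)`: the closure of `Ind ∩ U` stays inside
`U`, where `Ind` is the set of points of `A` whose local ring has no centre on `B` (the
indeterminacy locus of `A ⋯→ B`) — Piltant's «there is no bad `x`», the hypothesis of Step 5
(`ProjModel.exists_regLe_pair_of_closure_subset`). [cite: Piltant2013, Prop. 5.1 (proof, Step 5)] -/
def StraddleFree {k K : Type u} [Field k] [Field K] [Algebra k K] (A B : ProjModel k K)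
    (U : A.X.Opens) : Prop :=
  closure ({a : A.X | ¬ B.HasCentre (A.stalkSubring a)} ∩ (U : Set A.X)) ⊆ (U : Set A.X)

/-- **Straddle elimination at transcendence degree `d`** [OURS · L1 W5.2 · K5.2c re-key rung]:
for projective models `η : B → A` of a function field `K/k` with `trdeg_k K = d` and a non-empty
open `U ⊆ Reg A`, there are projective models `ρ : A' → A`, `B' → A'`, `θ : B' → B` with
`θ⁻¹(Reg B) ⊆ Reg B'`, `ρ⁻¹(U) ⊆ Reg A'`, and NO straddling component for `(A', ρ⁻¹ U, B')`.
At `d = 3` this is Piltant 2013, Lemma 5.6 for `P = P_reg` (a theorem: `straddleElimination_three`);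
at `d = 4` it is the located open step of kill test K5.2c (straddling curves = coheight-`3` bad
points, where quadratic accessibility fails: `Literature.Barriers.…accessibleInDim_iff`).
A statement, asserted nowhere for `d ≥ 4`. [cite: Piltant2013, Lemma 5.6; Cutkosky2009, p. 14] -/
@[conjecture] def StraddleElimination (d : ℕ) : Prop :=
  ∀ (k K : Type u) [Field k] [Field K] [Algebra k K], Algebra.trdeg k K = d →
    ∀ (A B : ProjModel k K) (_ : B.Hom A) (U : A.X.Opens),
      (U : Set A.X) ⊆ Scheme.regularLocus A.X → (U : Set A.X).Nonempty →
      ∃ (A' B' : ProjModel k K) (ρ : A'.Hom A) (_ : B'.Hom A') (θ : B'.Hom B),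
        θ.RegLe ∧ (∀ a' : A'.X, ρ.f a' ∈ U → IsRegularLocalRing (A'.X.presheaf.stalk a')) ∧
        StraddleFree A' B' (ρ.f ⁻¹ᵁ U)

variable {k K : Type u} [Field k] [Field K] [Algebra k K]

/-- The identity morphism of a projective model. [folklore] -/
def idHom (A : ProjModel k K) : A.Hom A where
  f := 𝟙 A.X
  f_π := Category.id_comp _
  gen_f := Category.comp_id _

/-- The underlying morphism of the identity is the identity. [folklore] -/
@[simp] theorem idHom_f (A : ProjModel k K) : (idHom A).f = 𝟙 A.X := rfl

/-- The identity preserves regular preimages. [folklore] -/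
theorem idHom_regLe (A : ProjModel k K) : (idHom A).RegLe :=
  fun _ h => h

/-! ## `d = 3`: straddle elimination HOLDS (the tree's bad-curve induction) -/

/-- **Straddle elimination at transcendence degree three** from Cossart–Piltant's
principalization: strong induction on `ProjModel.badMeasure` with the step
`ProjModel.exists_step`; when no bad point is left, `closure_inter_subset_of_forall_not_isBad`.
A CONDITIONAL result (named-fact hypothesis `CossartPiltant2019Principalization`).
[cite: Piltant2013, Lemma 5.6; CossartPiltant2019, Prop. 4.4] -/
theorem straddleElimination_three (hP : CossartPiltant2019Principalization.{u}) :
    StraddleElimination.{u} 3 := by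
  intro k K _ _ _ htr A B η U hU hUne
  suffices h : ∀ (n : ℕ) (A B : ProjModel k K) (_ : B.Hom A) (U : A.X.Opens),
      (U : Set A.X) ⊆ Scheme.regularLocus A.X → (U : Set A.X).Nonempty → badMeasure A U B = n →
      ∃ (A' B' : ProjModel k K) (ρ : A'.Hom A) (_ : B'.Hom A') (θ : B'.Hom B),
        θ.RegLe ∧ (∀ a' : A'.X, ρ.f a' ∈ U → IsRegularLocalRing (A'.X.presheaf.stalk a')) ∧
        StraddleFree A' B' (ρ.f ⁻¹ᵁ U) from
    h _ A B η U hU hUne rfl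
  intro n
  induction n using Nat.strong_induction_on with
  | _ n ih =>
  intro A B η U hU hUne hn
  by_cases hbad : ∃ x, IsBad A B U x
  · obtain ⟨x, hx⟩ := hbad
    obtain ⟨A', B', ρ, η', θ, hθ, hregU', hlt⟩ := exists_step hP htr η hU hx
    have hU' : ((ρ.f ⁻¹ᵁ U : A'.X.Opens) : Set A'.X) ⊆ Scheme.regularLocus A'.X :=
      preimage_subset_regularLocus ρ hregU'
    have hU'ne : ((ρ.f ⁻¹ᵁ U : A'.X.Opens) : Set A'.X).Nonempty := by
      refine ⟨genericPoint A'.X, ?_⟩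
      show ρ.f (genericPoint A'.X) ∈ U
      rw [ρ.f_genericPoint]
      exact A.genericPoint_mem hUne
    obtain ⟨A'', B'', ρ', η'', θ', hθ', hregU'', hsf⟩ :=
      ih _ (hn ▸ hlt) A' B' η' (ρ.f ⁻¹ᵁ U) hU' hU'ne rfl
    exact ⟨A'', B'', ρ'.comp ρ, η'', θ'.comp θ, hθ'.comp hθ, fun a ha => hregU'' a ha, hsf⟩
  · push Not at hbad
    refine ⟨A, B, idHom A, η, idHom B, idHom_regLe B, fun a ha => hU ?_, ?_⟩
    · simpa using ha
    · show closure ({a : A.X | ¬ B.HasCentre (A.stalkSubring a)} ∩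
          (((idHom A).f ⁻¹ᵁ U : A.X.Opens) : Set A.X)) ⊆ (((idHom A).f ⁻¹ᵁ U : A.X.Opens) : Set A.X)
      have hid : ((idHom A).f ⁻¹ᵁ U : A.X.Opens) = U := by
        ext a; simp
      rw [hid]
      exact closure_inter_subset_of_forall_not_isBad hbad

/-! ## Any `d`: two-model patching ⇐ principalization in dimension `d` ∧ straddle elimination -/

/-- **Piltant's Axiom 4 for `P_reg` on a regular open of a projective `d`-fold model**, from
principalization on regular excellent Noetherian integral `d`-dimensional schemes (the body of
`K52.PrincipalizationDim d`, taken unfolded as the hypothesis `hP`): the open subscheme `U ⊆ Reg M`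
is regular, excellent (of finite type over a field), Noetherian, integral, of dimension `d`.
[cite: CossartPiltant2019, Prop. 4.4 (arXiv v1: Prop. 4.3); Piltant2013, §2 Axiom 4] -/
theorem principalization_opens_of_principalizationDim {d : ℕ}
    (hP : ∀ (S : Scheme.{u}) [IsIntegral S] [IsNoetherian S], Scheme.IsRegular S →
      Scheme.IsExcellent S → topologicalKrullDim S = d → ∀ J : S.IdealSheafData, J ≠ ⊥ →
        ∃ (S' : Scheme.{u}) (σ : S' ⟶ S), IsRegularCentreBlowupSeq σ J ∧
          IsLocallyPrincipal (J.comap σ))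
    (M : ProjModel k K) (hdim : topologicalKrullDim M.X = d) (U : M.X.Opens)
    (hU : (U : Set M.X) ⊆ Scheme.regularLocus M.X) (hUne : (U : Set M.X).Nonempty)
    (J : (U : Scheme.{u}).IdealSheafData) (hJ : J ≠ ⊥) :
    ∃ (S' : Scheme.{u}) (σ : S' ⟶ U), IsRegularCentreBlowupSeq σ J ∧
      IsLocallyPrincipal (J.comap σ) := by
  haveI : Nonempty (U : Scheme.{u}) := hUne.to_subtype
  haveI : IsIntegral (U : Scheme.{u}) := isIntegral_of_isOpenImmersion U.ι
  haveI : CompactSpace (U : Scheme.{u}) :=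
    isCompact_iff_compactSpace.mp (NoetherianSpace.isCompact (U : Set M.X))
  haveI : IsNoetherian (U : Scheme.{u}) := ⟨⟩
  have hregU : Scheme.IsRegular (U : Scheme.{u}) := fun x => by
    have hx : (U.ι x) ∈ Scheme.regularLocus M.X := hU (by rw [Scheme.Opens.ι_apply]; exact x.2)
    haveI : IsRegularLocalRing (M.X.presheaf.stalk (U.ι x)) := hx
    exact IsRegularLocalRing.of_ringEquiv (asIso (U.ι.stalkMap x)).commRingCatIsoToRingEquiv
  have hexcU : Scheme.IsExcellent (U : Scheme.{u}) :=
    Scheme.isExcellent_of_locallyOfFiniteType Stacks07QW_field_holds (U.ι ≫ M.π)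
  have hdimU : topologicalKrullDim (U : Scheme.{u}) = d :=
    (topologicalKrullDim_opens_eq M.π U hUne).trans hdim
  exact hP (U : Scheme.{u}) hregU hexcU hdimU J hJ

/-- **Piltant's Prop. 5.1 at transcendence degree `d` from Axiom 4_d and straddle elimination**
[OURS · L1 W5.2]: if every non-zero ideal sheaf on every regular excellent Noetherian integral
`d`-dimensional scheme is principalized by blowing ups along regular centres in the
non-locally-principal loci (`hP`, the body of `K52.PrincipalizationDim d`) and
`StraddleElimination d` holds, then any two projective models of a function field of transcendence
degree `d` are dominated by one on which the preimages of both regular loci are regular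
(Step 2 — `exists_hom_regLe_of_regPrincipalization`; straddle elimination over `Reg M₁`; Step 5 —
`exists_regLe_pair_of_closure_subset`). At `d = 4` this isolates the architecture of kill test
K5.2c as «Axiom 4₄ ∧ StraddleElimination 4». A CONDITIONAL result.
[cite: Piltant2013, Prop. 5.1 (proof, Steps 2–5)] -/
theorem exists_regLe_pair_of_straddleElimination {d : ℕ}
    (hP : ∀ (S : Scheme.{u}) [IsIntegral S] [IsNoetherian S], Scheme.IsRegular S →
      Scheme.IsExcellent S → topologicalKrullDim S = d → ∀ J : S.IdealSheafData, J ≠ ⊥ →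
        ∃ (S' : Scheme.{u}) (σ : S' ⟶ S), IsRegularCentreBlowupSeq σ J ∧
          IsLocallyPrincipal (J.comap σ))
    (hSE : StraddleElimination.{u} d) (htr : Algebra.trdeg k K = d) (M₁ M₂ : ProjModel k K) :
    ∃ (N : ProjModel k K) (φ₁ : N.Hom M₁) (φ₂ : N.Hom M₂), φ₁.RegLe ∧ φ₂.RegLe := by
  -- Step 2: `N₀ → M₁`, `N₀ → M₂` with `Reg M₂` regular preimage
  have hdim₂ : topologicalKrullDim M₂.X = d := M₂.topologicalKrullDim_eq_of_trdeg htr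
  obtain ⟨N₀, η, φ₂, hφ₂⟩ := exists_hom_regLe_of_regPrincipalization M₁ M₂
    (fun U hU J hJ => principalization_opens_of_principalizationDim hP M₂ hdim₂ U hU.le
      (by rw [hU]; exact (Scheme.dense_regularLocus M₂.X).nonempty) J hJ)
  -- the regular locus of `M₁` as an open
  have hqe : Scheme.IsQuasiExcellent M₁.X :=
    (Scheme.isExcellent_of_locallyOfFiniteType Stacks07QW_field_holds M₁.π).isQuasiExcellent
  obtain ⟨U, hU⟩ := Scheme.exists_opens_coe_eq_regularLocus hqe
  have hUne : (U : Set M₁.X).Nonempty := by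
    rw [hU]; exact (Scheme.dense_regularLocus M₁.X).nonempty
  -- straddle elimination over `U = Reg M₁`
  obtain ⟨A', B', ρ, η', θ, hθ, hregU', hsf⟩ := hSE k K htr M₁ N₀ η U hU.le hUne
  have hU' : ((ρ.f ⁻¹ᵁ U : A'.X.Opens) : Set A'.X) ⊆ Scheme.regularLocus A'.X :=
    preimage_subset_regularLocus ρ hregU'
  have hU'ne : ((ρ.f ⁻¹ᵁ U : A'.X.Opens) : Set A'.X).Nonempty := by
    refine ⟨genericPoint A'.X, ?_⟩
    show ρ.f (genericPoint A'.X) ∈ U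
    rw [ρ.f_genericPoint]
    exact M₁.genericPoint_mem hUne
  -- Step 5 on the straddle-free state
  have hdimA' : topologicalKrullDim A'.X = d := A'.topologicalKrullDim_eq_of_trdeg htr
  obtain ⟨Y, ψA, ψB, hA, hB⟩ := exists_regLe_pair_of_closure_subset A' B' η' (ρ.f ⁻¹ᵁ U) hU' hU'ne
    (principalization_opens_of_principalizationDim hP A' hdimA' (ρ.f ⁻¹ᵁ U) hU' hU'ne) hsf
  refine ⟨Y, ψA.comp ρ, (ψB.comp θ).comp φ₂, fun y hy => hA y ?_, (hB.comp hθ).comp hφ₂⟩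
  show ρ.f (ψA.f y) ∈ (U : Set M₁.X)
  rw [hU]
  exact hy

-- At `d = 3` the two hypotheses are supplied by `CossartPiltant2019Principalization`
-- (`straddleElimination_three`), recovering the landed
-- `Literature.AlgebraicGeometry.Resolution.ProjModel.twoModelPatching_of_principalization`
-- (not restated here: dedup).

end K52c

end Summit.ResolutionOfSingularities.ResolutionOfSingularities.Theorems

end
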